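import Summits.QuantumFields.BalabanUV.Beta.FP.TowerQN2RowCopies
import Summits.QuantumFields.BalabanUV.Beta.FP.TowerNParityRowsEven
import Summits.QuantumFields.BalabanUV.Beta.FP.WoundEvenFamilyTorus
import Summits.QuantumFields.BalabanUV.Beta.NVertexWoundTorus

/-!
# `BalabanUV.Beta.FP.TowerQN2RowWound` — road «FP», binder row D1, ROUTE T (β1), (E4e²) PART 4: **THE RIGHT SIDE OF THE END WRAPPER v5's SECOND-ORDER ROWS
# `hQN₂ ∕ hHN₂`, READ** — the `μf` ∕ `ff` blocks of the periodised WOUND EVEN N-family `x w ↦ Σ'_e WN♮ μ y ν (y′ + (Mc B)∘e) x w` are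
# `½(Ŵ (fN a) b♭ − Ŵ b♭ (fN a))` ∕ `½(Ŵ b♭ b♭′ + Ŵ b♭′ b♭)` with `Ŵ := perF T (dper T (x w ↦ Σ'_e WN μ y ν (y′ + (Mc B)∘e) x w))` the torus matrix of the RAW wound
# family (the wound twins of v4's `TowerNParityRowsEven.WN_even_submatrix_μf ∕ _ff`), and **THE JUNCTION OF `hQN₂` DISPLAYED AS ONE ENTRYWISE `iff`**: with (H)
# `TowerQN2RowCopies.Qprime2_symm_apply_eq_sum_sum_perF_dper_copies` on the left, v5's row `hQN₂` at a label pair holds IFF the seam-currency left entry equals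
# `½(Ŵ (fN (x̄,κ₀)) (z♭,β) − Ŵ (z♭,β) (fN (x̄,κ₀)))` — rewriting only, NO table-word hypothesis displayed; and the same with `Ŵ` READ as an2 PART 16∕17's
# `perF T (W2SymOfK (AN …) (Lc^(n+2)) S^per Mt^per T2^{per,csf} M2^{per,cs} …)`

WHY (journal l.67786 A-1 ∕ INTENT-1, l.67789 an2 A-1 ∕ W-3, l.67797 A-2).  an2 PART 18 gives the torus face of the wound EVEN family in terms of the RAW wound family's torus
matrix (generic `d`); PART 16 `NVertexWoundPeriodised.dper_tsum_WN` ∕ PART 17 `NVertexWoundTorus.perF_dper_tsum_WN` read the latter as `perF T (W2SymOfK (AN …) (Lc^(n+2)) S^per Mt^per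
T2^{per,csf} M2^{per,cs})` and then word by word.  This file packages both in v5's row shapes and displays the junction of `hQN₂`.  The junction flag (an2 g68 l.67771): only the bi-vertex word has (H)'s `colN̂·colN̂ • (…)` shape, so the road displays NO
per-sector hypothesis — the (C1) table word at order 2 (an2, A-2 l.67742) is the proof of §3's right-hand statement, sector split inside.
WHAT ([folklore] parity∕`Matrix` bookkeeping BY NAME over an2 PART 18 `WoundEvenFamilyTorus.perF_dper_wound_evenHalf_apply` (the generic step, CONSUMED — an2 g68 INTENT-5
l.67788 ∕ overlap notice l.67789 ∕ road A-2 l.67797) and PART 17 `NVertexWoundTorus.perF_dper_tsum_WN`; no `def`, no `def … : Prop`, nothing cited, 0 sorry):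
§1 at the record (`d = 3`), v5's binder shapes (`Mc Pn fN hmN`, `hWN : ∀ n, VertexFamily₂ (WN …) (NN n) (CwN n) (δN n)`, `hδN`, and `hNN : ∀ n, NN n = Lc^(n+2)` =
`TowerNParityRowsEven.exists_NN_rows_even`'s fourth clause — v5 leaves `NN` free; the wound rows presuppose `NN n · Mc B = towerTorus Lc (fine Lc (Mc B)) (n+1)`, i.e.
(H) `towerTorus_fine_apply` + `hNN`): **`WN_wound_even_submatrix_μf`**, **`WN_wound_even_submatrix_ff`** (the two `submatrix` packagings of PART 18);
§2 per box (`M`), (H)'s letters VERBATIM: **`hQN2_row_iff_junction`** (right side on the RAW wound family's torus matrix `Ŵ`) and **`hQN2_row_iff_junction_per`** (right side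
on `X := perF T (W2SymOfK (AN (Roots.ctr Lc) (n+1)) (Lc^(n+2)) S^per Mt^per T2^{per,csf} M2^{per,cs} (μN a) (yN a) (μN a′) (yN a′))`, PART 17 `perF_dper_tsum_WN`).
WHAT THIS IS NOT: not the table word ∕ lock rows (an2); not `hQN2_of_road_data` unconditionally (= §3 `.mpr` fed by an2's word); not the H side's junction (`hHN₂` waits on the
order-2 Hessian-table word, SPEC-54 §6 — §2 gives its right side); nothing of Bałaban's asserted, valued or discharged; 0 estimates; 0∕4 row-D1 binders (hW, hR, D1Tel,
D1Rep); ROOT M‴ p325680 ∕ P5c ∕ D6 untouched; NOT (C1), NOT `hQN₂ ∕ hHN₂`, NOT (T-ID), NOT D1, NEVER «G-an2-4 closed», NOT BetaPertH, NOT continuum, NOT Clay.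

HONEST DEPENDENCY (page 1, mandatory): continuum YM on T⁴ ⇐ BetaPertH ∧ nine spine estimates (0/9 proved); BetaPertH ⇐ (D1) ∧ (D4) ∧ CAP+tail;
G-an2-4 gates asym, D1 and NE2/3/4.  HONEST FRAMING (cell contract, verbatim): «discharging `BetaPertH` makes Bałaban's UV stability UNCONDITIONAL —
a real constructive-QFT result; it is NOT the continuum limit and NOT the Clay problem.»  ABSOLUTE RULE (cell charter, verbatim): «No internally-minted
statement may enter as a cited fact. Every hypothesis is either kernel-proved in this package or a verbatim quotation of a PUBLISHED theorem with page
reference. The manuscript(s) under audit are NOT citable for their own disputed steps — they are the thing under adjudication; programme-internal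
(2001/route/tribunal) claims are never citable.»  Road «FP» OWNER, b2b-balaban-beta-d1-p3 gen 44, 2026-08-27.  No existing file touched.
-/

noncomputable section

open scoped BigOperators

namespace Summit.QuantumFields.BalabanUV.Beta.FP.TowerQN2RowWound

open Finset Matrix
open Literature.MathematicalPhysics.QuantumFieldTheory
open Literature.MathematicalPhysics.QuantumFieldTheory.Balaban1983to89
open Literature.MathematicalPhysics.QuantumFieldTheory.Balaban1983to89.Beta
open B4TorusKernel.MultiPeriod (translate)
open B5Prop11Plancherel (fine)
open B6Lemma24Torus (pbox)
open AffineAveraging (Site box)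
open AveragingContoursRooted (ctr ctrOff)
open AveragingHessianKernels (packVH)
open ExpKernelCalculus (MKer VertexFamily₂)
open OneStepResolventKernel (Fib)
open BalabanStepW2 (M2Of)
open SecondOrderResponse (W2SymOfK)
open Summit.QuantumFields.BalabanUV.Beta.TameKernelCalculus (trK)
open Summit.QuantumFields.BalabanUV.Beta.BorderedHessian (sgnF sgnF_inl sgnF_inr sgnK)
open Summit.QuantumFields.BalabanUV.Beta.BorderedHessian (stepScale)
open Summit.QuantumFields.BalabanUV.Beta.AxialDressingRooted (one_le_of_neZero)
open Summit.QuantumFields.BalabanUV.Beta.SpineRooted (SpureRecOf T2RecOf)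
open Summit.QuantumFields.BalabanUV.Beta.CompositeCorrectorDress (compChart)
open Summit.QuantumFields.BalabanUV.Beta.CompositeOneShotJets (tabsComp)
open Summit.QuantumFields.BalabanUV.Beta.SymAveragingHessianCounts (symLinKerAt symVhKerAt)
open Summit.QuantumFields.BalabanUV.Beta.SymAveragingMixedJetTables (symVh2KerAt)
open Summit.QuantumFields.BalabanUV.Beta.CompositeVertexKernelRec (compVH2Ker)
open Summit.QuantumFields.BalabanUV.Beta.CompositeOneShotJetData (Roots Pins AN WN)
open Summit.QuantumFields.BalabanUV.Beta.FP.KernelPeriodisationFib (Idx perF)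
open Summit.QuantumFields.BalabanUV.Beta.FP.KernelPeriodisationFibLoc (dper)
open Summit.QuantumFields.BalabanUV.Beta.FP.TorusGaugeCovariance (tgrad)
open Summit.QuantumFields.BalabanUV.Beta.FP.TorusGaugeCovariancePairing (wrapPt)
open Summit.QuantumFields.BalabanUV.Beta.FP.TorusCompositeObjects (towerTorus)
open Summit.QuantumFields.BalabanUV.Beta.FP.TorusCompositeCovariance (itRoot)
open Summit.QuantumFields.BalabanUV.Beta.FP.TorusCompositeObjectsG (compRowsSym)
open Summit.QuantumFields.BalabanUV.Beta.FP.TorusCompositeCovarianceOneSym (compIns₁Sym)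
open Summit.QuantumFields.BalabanUV.Beta.FP.TorusCompositeCovarianceTwoPolarSym (compIns₂₂Sym)
open Summit.QuantumFields.BalabanUV.Beta.FP.TowerNParityRowsEven (WN_swap)
open Summit.QuantumFields.BalabanUV.Beta.FP.TowerQN2RowCopies (towerTorus_fine_apply Qprime2_symm_apply_eq_sum_sum_perF_dper_copies)
open Summit.QuantumFields.BalabanUV.Beta.FP.WoundEvenFamilyTorus (perF_dper_wound_evenHalf_apply)
open Summit.QuantumFields.BalabanUV.Beta.NVertexWoundTorus (perF_dper_tsum_WN)

/-! ## §1 At the record, v5's binder shapes: the right sides of `hQN₂ ∕ hHN₂` in terms of the RAW wound N-family's torus matrix -/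

section Record

variable {Lc : ℕ} [NeZero Lc] (Mc : ℕ → (Fin (3 + 1) → ℕ)) [∀ B μ, NeZero (Mc B μ)] (Pn : Pins)
  (fN : ∀ n : ℕ, ∀ B : ℕ, (↥(pbox (Mc B)) × Fin (3 + 1)) → Idx (towerTorus Lc (fine Lc (Mc B)) (n + 1)) (Fib 3))
  (hmN : ∀ n : ℕ, ∀ B : ℕ, ∀ a : (↥(pbox (Mc B)) × Fin (3 + 1)), ∃ m : Fin (3 + 1), ((fN n) B a).2 = Sum.inr m)
  {NN : ℕ → ℕ} {CwN δN : ℕ → ℝ} (hNN : ∀ n : ℕ, NN n = Lc ^ (n + 1 + 1))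
  (hWN : ∀ n : ℕ, VertexFamily₂ (WN (Roots.ctr Lc) Pn (n + 1)) (NN n) (CwN n) (δN n)) (hδN : ∀ n : ℕ, 0 < δN n)

omit [NeZero Lc] [∀ B μ, NeZero (Mc B μ)] in
include hNN in
/-- [folklore] the wound rows' box sentence: `towerTorus Lc (fine Lc (Mc B)) (n+1) = (NN n)·(Mc B)` ((H) `towerTorus_fine_apply` + `hNN`). -/
theorem towerTorus_eq_NN_mul (n B : ℕ) (i : Fin (3 + 1)) : towerTorus Lc (fine Lc (Mc B)) (n + 1) i = NN n * Mc B i := by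
  rw [hNN n]; exact towerTorus_fine_apply (Mc B) n i

include hmN hNN hWN hδN in
/-- [folklore] **`WN_wound_even_submatrix_μf` — THE RIGHT SIDE OF v5's ROW `hQN₂`, READ**: `Ŵ♮_wound.sub (fN n B) e_F = Matrix.of (a b ↦ ½(Ŵ (fN a) b̃ − Ŵ b̃ (fN a)))` with
`Ŵ := perF T (dper T (x w ↦ Σ'_e WN (Roots.ctr Lc) Pn (n+1) μ y ν (translate (Mc B) y′ e) x w))`, `T := towerTorus Lc (fine Lc (Mc B)) (n+1)` — the wound twin of
v4's `TowerNParityRowsEven.WN_even_submatrix_μf` (an2 PART 18 `perF_dper_wound_evenHalf_apply` at `WN_swap` ∕ `hWN n` ∕ `hδN n`; `sgnF (inr ·)·sgnF (inl ·) = −1`). -/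
theorem WN_wound_even_submatrix_μf (n : ℕ) (μ : Fin (3 + 1)) (y : Fin (3 + 1) → ℤ) (ν : Fin (3 + 1)) (y' : Fin (3 + 1) → ℤ) (B : ℕ) :
    (perF (towerTorus Lc (fine Lc (Mc B)) (n + 1)) (dper (towerTorus Lc (fine Lc (Mc B)) (n + 1))
        (fun x w a b => ∑' e : Site (3 + 1), ((1 / 2 : ℝ) • (WN (Roots.ctr Lc) Pn (n + 1) μ y ν (translate (Mc B) y' e)
          + sgnK (trK (WN (Roots.ctr Lc) Pn (n + 1) μ y ν (translate (Mc B) y' e))))) x w a b))).submatrix ((fN n) B)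
        (fun b : ↥(pbox (towerTorus Lc (fine Lc (Mc B)) (n + 1))) × Fin (3 + 1) => ((b.1, Sum.inl b.2) : Idx (towerTorus Lc (fine Lc (Mc B)) (n + 1)) (Fib 3)))
      = Matrix.of fun (a : ↥(pbox (Mc B)) × Fin (3 + 1)) (b : ↥(pbox (towerTorus Lc (fine Lc (Mc B)) (n + 1))) × Fin (3 + 1)) =>
          (1 / 2 : ℝ) * ((perF (towerTorus Lc (fine Lc (Mc B)) (n + 1)) (dper (towerTorus Lc (fine Lc (Mc B)) (n + 1))
                (fun x w a b => ∑' e : Site (3 + 1), WN (Roots.ctr Lc) Pn (n + 1) μ y ν (translate (Mc B) y' e) x w a b))) (((fN n) B) a) (b.1, Sum.inl b.2)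
            - (perF (towerTorus Lc (fine Lc (Mc B)) (n + 1)) (dper (towerTorus Lc (fine Lc (Mc B)) (n + 1))
                (fun x w a b => ∑' e : Site (3 + 1), WN (Roots.ctr Lc) Pn (n + 1) μ y ν (translate (Mc B) y' e) x w a b))) (b.1, Sum.inl b.2) (((fN n) B) a)) := by
  ext a b
  obtain ⟨m, hm⟩ := (hmN n) B a
  rw [Matrix.submatrix_apply, Matrix.of_apply,
    perF_dper_wound_evenHalf_apply _ (towerTorus_eq_NN_mul Mc hNN n B) (fun μ₁ y₁ ν₁ y₁' => WN_swap (Roots.ctr Lc) Pn (n + 1) μ₁ y₁ ν₁ y₁') (hWN n) (hδN n),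
    hm, sgnF_inr, sgnF_inl]
  ring

include hNN hWN hδN in
/-- [folklore] **`WN_wound_even_submatrix_ff` — THE RIGHT SIDE OF v5's ROW `hHN₂`, READ**: `Ŵ♮_wound.sub e_F e_F = Matrix.of (b b′ ↦ ½(Ŵ b̃ b̃′ + Ŵ b̃′ b̃))`, same `Ŵ`. -/
theorem WN_wound_even_submatrix_ff (n : ℕ) (μ : Fin (3 + 1)) (y : Fin (3 + 1) → ℤ) (ν : Fin (3 + 1)) (y' : Fin (3 + 1) → ℤ) (B : ℕ) :
    (perF (towerTorus Lc (fine Lc (Mc B)) (n + 1)) (dper (towerTorus Lc (fine Lc (Mc B)) (n + 1))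
        (fun x w a b => ∑' e : Site (3 + 1), ((1 / 2 : ℝ) • (WN (Roots.ctr Lc) Pn (n + 1) μ y ν (translate (Mc B) y' e)
          + sgnK (trK (WN (Roots.ctr Lc) Pn (n + 1) μ y ν (translate (Mc B) y' e))))) x w a b))).submatrix
        (fun b : ↥(pbox (towerTorus Lc (fine Lc (Mc B)) (n + 1))) × Fin (3 + 1) => ((b.1, Sum.inl b.2) : Idx (towerTorus Lc (fine Lc (Mc B)) (n + 1)) (Fib 3)))
        (fun b : ↥(pbox (towerTorus Lc (fine Lc (Mc B)) (n + 1))) × Fin (3 + 1) => ((b.1, Sum.inl b.2) : Idx (towerTorus Lc (fine Lc (Mc B)) (n + 1)) (Fib 3)))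
      = Matrix.of fun b b' : ↥(pbox (towerTorus Lc (fine Lc (Mc B)) (n + 1))) × Fin (3 + 1) =>
          (1 / 2 : ℝ) * ((perF (towerTorus Lc (fine Lc (Mc B)) (n + 1)) (dper (towerTorus Lc (fine Lc (Mc B)) (n + 1))
                (fun x w a b => ∑' e : Site (3 + 1), WN (Roots.ctr Lc) Pn (n + 1) μ y ν (translate (Mc B) y' e) x w a b))) (b.1, Sum.inl b.2) (b'.1, Sum.inl b'.2)
            + (perF (towerTorus Lc (fine Lc (Mc B)) (n + 1)) (dper (towerTorus Lc (fine Lc (Mc B)) (n + 1))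
                (fun x w a b => ∑' e : Site (3 + 1), WN (Roots.ctr Lc) Pn (n + 1) μ y ν (translate (Mc B) y' e) x w a b))) (b'.1, Sum.inl b'.2) (b.1, Sum.inl b.2)) := by
  ext b b'
  rw [Matrix.submatrix_apply, Matrix.of_apply,
    perF_dper_wound_evenHalf_apply _ (towerTorus_eq_NN_mul Mc hNN n B) (fun μ₁ y₁ ν₁ y₁' => WN_swap (Roots.ctr Lc) Pn (n + 1) μ₁ y₁ ν₁ y₁') (hWN n) (hδN n),
    sgnF_inl, sgnF_inl, one_mul, one_mul]

end Record

/-! ## §2 Per box, (H)'s letters VERBATIM: v5's row `hQN₂` at a label pair IS the junction equation, entrywise -/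

section Junction

variable {Lc : ℕ} [NeZero Lc] (M : Fin (3 + 1) → ℕ) [∀ μ, NeZero (M μ)] (n : ℕ) (c : ℝ) (Pn : Pins)
  -- v5's `hWN n` ∕ `hδN n` at the storey, blocking `NN = Lc^(n+2)` (v4 `TowerNParityRowsEven.exists_NN_rows_even`'s fourth clause)
  {NN : ℕ} {CwN δN : ℝ} (hNN : NN = Lc ^ (n + 1 + 1)) (hWN : VertexFamily₂ (WN (Roots.ctr Lc) Pn (n + 1)) NN CwN δN) (hδN : 0 < δN)
  -- (H) `TowerQN2RowCopies` §2's letters VERBATIM: the slot map, the root, the labels, #6's 𝔔-side namings, the pinned directions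
variable (fN : (↥(pbox M) × Fin (3 + 1)) → Idx (towerTorus Lc (fine Lc M) (n + 1)) (Fib 3))
  (hfN : ∀ a : ↥(pbox M) × Fin (3 + 1),
    fN a = (wrapPt (towerTorus Lc (fine Lc M) (n + 1)) (((Lc ^ (n + 1 + 1) : ℕ) : ℤ) • (a.1 : Site (3 + 1))), Sum.inr a.2))
variable (hc : ctrOff (3 + 1) Lc ∈ box (3 + 1) Lc)
  {κ : Type*} [Fintype κ] [DecidableEq κ] (yN : κ → Site (3 + 1)) (μN : κ → Fin (3 + 1))
  (hv : (κ → ℝ) → (↥(pbox (towerTorus Lc (fine Lc M) (n + 1))) × Fin (3 + 1) → ℝ))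
  (hhvl : ∀ (r : ℝ) (x y : κ → ℝ), hv (r • x + y) = r • hv x + hv y)
  (lv : (κ → ℝ) → ↥(pbox (towerTorus Lc (fine Lc M) (n + 1))) → ℝ)
  (hlv : ∀ (r : ℝ) (x y : κ → ℝ), lv (r • x + y) = r • lv x + lv y)
  (hJW : ∀ (a : κ) (b : ↥(pbox (towerTorus Lc (fine Lc M) (n + 1))) × Fin (3 + 1)), hv (Pi.single a 1) b
      = perF (towerTorus Lc (fine Lc M) (n + 1)) (AN (Roots.ctr Lc) (n + 1)) (b.1, Sum.inl b.2)
          (wrapPt (towerTorus Lc (fine Lc M) (n + 1)) (((Lc ^ (n + 1 + 1) : ℕ) : ℤ) • yN a), Sum.inr (μN a))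
        - ∑ s : ↥(pbox (towerTorus Lc (fine Lc M) (n + 1))), tgrad (towerTorus Lc (fine Lc M) (n + 1)) (b.1, Sum.inl b.2) s * lv (Pi.single a 1) s)
  (𝔔₀ : Matrix ((↥(pbox M) × Fin (3 + 1))) (↥(pbox (towerTorus Lc (fine Lc M) (n + 1))) × Fin (3 + 1)) ℝ)
  (h𝔔₀' : 𝔔₀ = (compRowsSym Lc M (fun i : ℕ => n + 1 - (i - 1)) (fun _ : ℕ => ctrOff (3 + 1) Lc) (n + 1 + 1) :
      Matrix ((↥(pbox M) × Fin (3 + 1))) (↥(pbox (towerTorus Lc (fine Lc M) (n + 1))) × Fin (3 + 1)) ℝ))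
  (𝔔₁f : (κ → ℝ) → Matrix ((↥(pbox M) × Fin (3 + 1))) (↥(pbox (towerTorus Lc (fine Lc M) (n + 1))) × Fin (3 + 1)) ℝ)
  (h𝔔₁' : ∀ v, 𝔔₁f v = c • compIns₁Sym Lc M (fun i : ℕ => n + 1 - (i - 1)) (fun _ : ℕ => ctrOff (3 + 1) Lc) (n + 1 + 1) (hv v))
  (𝔔₂f : (κ → ℝ) → (κ → ℝ) → Matrix ((↥(pbox M) × Fin (3 + 1))) (↥(pbox (towerTorus Lc (fine Lc M) (n + 1))) × Fin (3 + 1)) ℝ)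
  (h𝔔₂' : ∀ v v', (1 / 2 : ℝ) • (𝔔₂f v v' + 𝔔₂f v' v)
    = c ^ 2 • compIns₂₂Sym Lc M (fun i : ℕ => n + 1 - (i - 1)) (fun _ : ℕ => ctrOff (3 + 1) Lc) (n + 1 + 1) (hv v) (hv v'))
  (Xbf : (κ → ℝ) → Matrix ((↥(pbox M) × Fin (3 + 1))) ((↥(pbox M) × Fin (3 + 1))) ℝ)
  (hXbf : ∀ v, Xbf v = c • Matrix.diagonal (fun a : (↥(pbox M) × Fin (3 + 1)) =>
    lv v (itRoot Lc M (fun _ : ℕ => ctrOff (3 + 1) Lc) (fun _ => hc) (n + 1 + 1) a.1)))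
  (𝔔'₂f : (κ → ℝ) → (κ → ℝ) → Matrix ((↥(pbox M) × Fin (3 + 1))) (↥(pbox (towerTorus Lc (fine Lc M) (n + 1))) × Fin (3 + 1)) ℝ)
  (h𝔔'₂f : ∀ v v', 𝔔'₂f v v' = Xbf v * Xbf v' * 𝔔₀ + (Xbf v * 𝔔₁f v' + Xbf v * 𝔔₀ * (-(c • Matrix.diagonal (fun b : (↥(pbox (towerTorus Lc (fine Lc M) (n + 1))) × Fin (3 + 1)) => lv v' b.1))))
      + ((Xbf v * 𝔔₁f v' + Xbf v * 𝔔₀ * (-(c • Matrix.diagonal (fun b : (↥(pbox (towerTorus Lc (fine Lc M) (n + 1))) × Fin (3 + 1)) => lv v' b.1)))) + (𝔔₂f v v' + 𝔔₁f v * (-(c • Matrix.diagonal (fun b : (↥(pbox (towerTorus Lc (fine Lc M) (n + 1))) × Fin (3 + 1)) => lv v' b.1))) + (𝔔₁f v * (-(c • Matrix.diagonal (fun b : (↥(pbox (towerTorus Lc (fine Lc M) (n + 1))) × Fin (3 + 1)) => lv v' b.1))) + 𝔔₀ * ((-(c • Matrix.diagonal (fun b : (↥(pbox (towerTorus Lc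 (fine Lc M) (n + 1))) × Fin (3 + 1)) => lv v b.1))) * (-(c • Matrix.diagonal (fun b : (↥(pbox (towerTorus Lc (fine Lc M) (n + 1))) × Fin (3 + 1)) => lv v' b.1))))))))
  (r : ℝ) (a a' : κ)

omit [Fintype κ] in
include hNN hWN hδN hfN hhvl hlv hJW h𝔔₀' h𝔔₁' h𝔔₂' hXbf h𝔔'₂f in
/-- [folklore] **`hQN2_row_iff_junction` — v5's ROW `hQN₂` AT THE LABEL PAIR `(μN a, yN a; μN a′, yN a′)`, PER BOX, IS THE JUNCTION EQUATION ENTRYWISE**: with #6's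
letters and the slot map `fN`, the row «`½•(𝔔′₂f (r•e_a) (r•e_{a′}) + 𝔔′₂f (r•e_{a′}) (r•e_a)) = Ŵ♮_wound.sub fN e_F`» holds IFF for every entry
`(c²·r·r·Σ_full) · Σ_b Σ_{b′} colN̂_a b · (colN̂_{a′} b′ · Ĝ_T(b,b′) (fN (x̄,κ₀)) (z♭,β)) = ½(Ŵ (fN (x̄,κ₀)) (z♭,β) − Ŵ (z♭,β) (fN (x̄,κ₀)))`,
`Ŵ := perF T (dper T (x w ↦ Σ'_e WN (Roots.ctr Lc) Pn (n+1) (μN a) (yN a) (μN a′) (translate M (yN a′) e) x w))` — REWRITING ONLY ((H)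
`Qprime2_symm_apply_eq_sum_sum_perF_dper_copies` on the left, an2 PART 18 `perF_dper_wound_evenHalf_apply` on the right); the right-hand statement is what the (C1)
table word at order 2 proves (an2 PART 16 `dper_tsum_WN` reads `dper T (raw wound) = W2SymOfK (AN …) (Lc^(n+2)) S^per Mt^per T2^{per,csf} M2^{per,cs}`, PART 17 its
torus words); NO table-word hypothesis is displayed here. -/
theorem hQN2_row_iff_junction :
    ((1 / 2 : ℝ) • (𝔔'₂f (r • (Pi.single a (1 : ℝ) : κ → ℝ)) (r • (Pi.single a' (1 : ℝ) : κ → ℝ))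
          + 𝔔'₂f (r • (Pi.single a' (1 : ℝ) : κ → ℝ)) (r • (Pi.single a (1 : ℝ) : κ → ℝ)))
        = (perF (towerTorus Lc (fine Lc M) (n + 1)) (dper (towerTorus Lc (fine Lc M) (n + 1))
            (fun X Z i₁ i₂ => ∑' e : Site (3 + 1), ((1 / 2 : ℝ) • (WN (Roots.ctr Lc) Pn (n + 1) (μN a) (yN a) (μN a') (translate M (yN a') e)
            + sgnK (trK (WN (Roots.ctr Lc) Pn (n + 1) (μN a) (yN a) (μN a') (translate M (yN a') e))))) X Z i₁ i₂))).submatrix fN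
            (fun b : ↥(pbox (towerTorus Lc (fine Lc M) (n + 1))) × Fin (3 + 1) => ((b.1, Sum.inl b.2) : Idx (towerTorus Lc (fine Lc M) (n + 1)) (Fib 3))))
      ↔ ∀ (x : ↥(pbox M)) (κ₀ : Fin (3 + 1)) (z : ↥(pbox (towerTorus Lc (fine Lc M) (n + 1)))) (β : Fin (3 + 1)),
              (c ^ 2 * r * r * ∏ ℓ ∈ range (n + 1 + 1), (stepScale 3 Lc ℓ * ((box (3 + 1) Lc).card : ℝ))) *
              ∑ b : ↥(pbox (towerTorus Lc (fine Lc M) (n + 1))) × Fin (3 + 1), ∑ b' : ↥(pbox (towerTorus Lc (fine Lc M) (n + 1))) × Fin (3 + 1),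
                perF (towerTorus Lc (fine Lc M) (n + 1)) (AN (Roots.ctr Lc) (n + 1)) (b.1, Sum.inl b.2)
                    (wrapPt (towerTorus Lc (fine Lc M) (n + 1)) (((Lc ^ (n + 1 + 1) : ℕ) : ℤ) • yN a), Sum.inr (μN a)) *
                  (perF (towerTorus Lc (fine Lc M) (n + 1)) (AN (Roots.ctr Lc) (n + 1)) (b'.1, Sum.inl b'.2)
                      (wrapPt (towerTorus Lc (fine Lc M) (n + 1)) (((Lc ^ (n + 1 + 1) : ℕ) : ℤ) • yN a'), Sum.inr (μN a')) *
                    perF (towerTorus Lc (fine Lc M) (n + 1)) (dper (towerTorus Lc (fine Lc M) (n + 1)) (fun X Z a₀ e₀ => ∑' m₂ : Site (3 + 1),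
                      packVH (fun μ y f f' => compVH2Ker (fun _ : ℕ => symLinKerAt (ctr (3 + 1) Lc) Lc) (fun _ : ℕ => symVhKerAt (ctr (3 + 1) Lc) Lc)
                        (fun (_ : ℕ) μ y g g₁ g₂ => (1 / 2 : ℝ) * (symVh2KerAt (ctr (3 + 1) Lc) Lc μ y g g₁ g₂ + symVh2KerAt (ctr (3 + 1) Lc) Lc μ y g g₂ g₁)) Lc (n + 1 + 1) μ y f
                          (b.2, (b.1 : Site (3 + 1))) f') (Lc ^ (n + 1 + 1)) b'.2 (translate (towerTorus Lc (fine Lc M) (n + 1)) (b'.1 : Site (3 + 1)) m₂) X Z a₀ e₀))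
                      (fN (x, κ₀)) ((z, Sum.inl β) : Idx (towerTorus Lc (fine Lc M) (n + 1)) (Fib 3)))
          = (1 / 2 : ℝ) * ((perF (towerTorus Lc (fine Lc M) (n + 1)) (dper (towerTorus Lc (fine Lc M) (n + 1))
                (fun X Z i₁ i₂ => ∑' e : Site (3 + 1), WN (Roots.ctr Lc) Pn (n + 1) (μN a) (yN a) (μN a') (translate M (yN a') e) X Z i₁ i₂))) (fN (x, κ₀)) ((z, Sum.inl β) : Idx (towerTorus Lc (fine Lc M) (n + 1)) (Fib 3))
              - (perF (towerTorus Lc (fine Lc M) (n + 1)) (dper (towerTorus Lc (fine Lc M) (n + 1))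
                (fun X Z i₁ i₂ => ∑' e : Site (3 + 1), WN (Roots.ctr Lc) Pn (n + 1) (μN a) (yN a) (μN a') (translate M (yN a') e) X Z i₁ i₂))) ((z, Sum.inl β) : Idx (towerTorus Lc (fine Lc M) (n + 1)) (Fib 3)) (fN (x, κ₀))) := by
  have hT : ∀ i, towerTorus Lc (fine Lc M) (n + 1) i = NN * M i := fun i => by rw [hNN]; exact towerTorus_fine_apply M n i
  have hE : ∀ (x : ↥(pbox M)) (κ₀ : Fin (3 + 1)) (z : ↥(pbox (towerTorus Lc (fine Lc M) (n + 1)))) (β : Fin (3 + 1)),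
      (perF (towerTorus Lc (fine Lc M) (n + 1)) (dper (towerTorus Lc (fine Lc M) (n + 1))
            (fun X Z i₁ i₂ => ∑' e : Site (3 + 1), ((1 / 2 : ℝ) • (WN (Roots.ctr Lc) Pn (n + 1) (μN a) (yN a) (μN a') (translate M (yN a') e)
            + sgnK (trK (WN (Roots.ctr Lc) Pn (n + 1) (μN a) (yN a) (μN a') (translate M (yN a') e))))) X Z i₁ i₂))).submatrix fN
            (fun b : ↥(pbox (towerTorus Lc (fine Lc M) (n + 1))) × Fin (3 + 1) => ((b.1, Sum.inl b.2) : Idx (towerTorus Lc (fine Lc M) (n + 1)) (Fib 3))) (x, κ₀) (z, β)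
        = (1 / 2 : ℝ) * ((perF (towerTorus Lc (fine Lc M) (n + 1)) (dper (towerTorus Lc (fine Lc M) (n + 1))
                (fun X Z i₁ i₂ => ∑' e : Site (3 + 1), WN (Roots.ctr Lc) Pn (n + 1) (μN a) (yN a) (μN a') (translate M (yN a') e) X Z i₁ i₂))) (fN (x, κ₀)) ((z, Sum.inl β) : Idx (towerTorus Lc (fine Lc M) (n + 1)) (Fib 3))
              - (perF (towerTorus Lc (fine Lc M) (n + 1)) (dper (towerTorus Lc (fine Lc M) (n + 1))
                (fun X Z i₁ i₂ => ∑' e : Site (3 + 1), WN (Roots.ctr Lc) Pn (n + 1) (μN a) (yN a) (μN a') (translate M (yN a') e) X Z i₁ i₂))) ((z, Sum.inl β) : Idx (towerTorus Lc (fine Lc M) (n + 1)) (Fib 3)) (fN (x, κ₀))) := by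
    intro x κ₀ z β
    obtain ⟨m, hm⟩ : ∃ m : Fin (3 + 1), (fN (x, κ₀)).2 = Sum.inr m := ⟨κ₀, by rw [hfN (x, κ₀)]⟩
    rw [Matrix.submatrix_apply, perF_dper_wound_evenHalf_apply _ hT (fun μ₁ y₁ ν₁ y₁' => WN_swap (Roots.ctr Lc) Pn (n + 1) μ₁ y₁ ν₁ y₁') hWN hδN, hm,
      sgnF_inr, sgnF_inl]
    ring
  constructor
  · intro h x κ₀ z β
    have h1 := congrFun (congrFun h (x, κ₀)) (z, β)
    rw [Qprime2_symm_apply_eq_sum_sum_perF_dper_copies M n c fN hfN hc yN μN hv hhvl lv hlv hJW 𝔔₀ h𝔔₀' 𝔔₁f h𝔔₁' 𝔔₂f h𝔔₂' Xbf hXbf 𝔔'₂f h𝔔'₂f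
      r a a' x κ₀ z β, hE] at h1
    exact h1
  · intro h
    refine Matrix.ext fun p q => ?_
    obtain ⟨x, κ₀⟩ := p
    obtain ⟨z, β⟩ := q
    rw [Qprime2_symm_apply_eq_sum_sum_perF_dper_copies M n c fN hfN hc yN μN hv hhvl lv hlv hJW 𝔔₀ h𝔔₀' 𝔔₁f h𝔔₁' 𝔔₂f h𝔔₂' Xbf hXbf 𝔔'₂f h𝔔'₂f
      r a a' x κ₀ z β, hE]
    exact h x κ₀ z β

omit [Fintype κ] in
include hNN hWN hδN hfN hhvl hlv hJW h𝔔₀' h𝔔₁' h𝔔₂' hXbf h𝔔'₂f in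
/-- [folklore] **`hQN2_row_iff_junction_per` — THE SAME `iff`, RIGHT SIDE AT an2 PART 16∕17's LETTER**: v5's row `hQN₂` at the label pair, per box, holds IFF for every entry
`(c²·r·r·Σ_full) · Σ_b Σ_{b′} colN̂_a b · (colN̂_{a′} b′ · Ĝ_T(b,b′) (fN (x̄,κ₀)) (z♭,β)) = ½(X (fN (x̄,κ₀)) (z♭,β) − X (z♭,β) (fN (x̄,κ₀)))` with
`X := perF T (W2SymOfK (AN (Roots.ctr Lc) (n+1)) (Lc^(n+2)) S^per Mt^per T2^{per,csf} M2^{per,cs} (μN a) (yN a) (μN a′) (yN a′))` spelled as in PART 16 `dper_tsum_WN` ∕ PART 17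
`perF_dper_tsum_WN` at `R := Roots.ctr Lc`, `P := Pn`, `j := n+1`, `M := T`, `M′ := M`, `hM := towerTorus_fine_apply M n` (`hQN2_row_iff_junction` + PART 17 `perF_dper_tsum_WN`) —
the LEFT summands are `TowerQN2RowLeftPeel`'s, the RIGHT words PART 17's `perF_W2SymOfK_N ∕ perF_W2OfK_N ∕ perF_vertex2OfK_N ∕ perF_mixOfK_N ∕ perF_resp_N`; what makes the two
sides equal is the (C1) table word at order 2 (an2), NOT displayed here. -/
theorem hQN2_row_iff_junction_per :
    ((1 / 2 : ℝ) • (𝔔'₂f (r • (Pi.single a (1 : ℝ) : κ → ℝ)) (r • (Pi.single a' (1 : ℝ) : κ → ℝ))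
          + 𝔔'₂f (r • (Pi.single a' (1 : ℝ) : κ → ℝ)) (r • (Pi.single a (1 : ℝ) : κ → ℝ)))
        = (perF (towerTorus Lc (fine Lc M) (n + 1)) (dper (towerTorus Lc (fine Lc M) (n + 1))
            (fun X Z i₁ i₂ => ∑' e : Site (3 + 1), ((1 / 2 : ℝ) • (WN (Roots.ctr Lc) Pn (n + 1) (μN a) (yN a) (μN a') (translate M (yN a') e)
            + sgnK (trK (WN (Roots.ctr Lc) Pn (n + 1) (μN a) (yN a) (μN a') (translate M (yN a') e))))) X Z i₁ i₂))).submatrix fN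
            (fun b : ↥(pbox (towerTorus Lc (fine Lc M) (n + 1))) × Fin (3 + 1) => ((b.1, Sum.inl b.2) : Idx (towerTorus Lc (fine Lc M) (n + 1)) (Fib 3))))
      ↔ ∀ (x : ↥(pbox M)) (κ₀ : Fin (3 + 1)) (z : ↥(pbox (towerTorus Lc (fine Lc M) (n + 1)))) (β : Fin (3 + 1)),
              (c ^ 2 * r * r * ∏ ℓ ∈ range (n + 1 + 1), (stepScale 3 Lc ℓ * ((box (3 + 1) Lc).card : ℝ))) *
              ∑ b : ↥(pbox (towerTorus Lc (fine Lc M) (n + 1))) × Fin (3 + 1), ∑ b' : ↥(pbox (towerTorus Lc (fine Lc M) (n + 1))) × Fin (3 + 1),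
                perF (towerTorus Lc (fine Lc M) (n + 1)) (AN (Roots.ctr Lc) (n + 1)) (b.1, Sum.inl b.2)
                    (wrapPt (towerTorus Lc (fine Lc M) (n + 1)) (((Lc ^ (n + 1 + 1) : ℕ) : ℤ) • yN a), Sum.inr (μN a)) *
                  (perF (towerTorus Lc (fine Lc M) (n + 1)) (AN (Roots.ctr Lc) (n + 1)) (b'.1, Sum.inl b'.2)
                      (wrapPt (towerTorus Lc (fine Lc M) (n + 1)) (((Lc ^ (n + 1 + 1) : ℕ) : ℤ) • yN a'), Sum.inr (μN a')) *
                    perF (towerTorus Lc (fine Lc M) (n + 1)) (dper (towerTorus Lc (fine Lc M) (n + 1)) (fun X Z a₀ e₀ => ∑' m₂ : Site (3 + 1),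
                      packVH (fun μ y f f' => compVH2Ker (fun _ : ℕ => symLinKerAt (ctr (3 + 1) Lc) Lc) (fun _ : ℕ => symVhKerAt (ctr (3 + 1) Lc) Lc)
                        (fun (_ : ℕ) μ y g g₁ g₂ => (1 / 2 : ℝ) * (symVh2KerAt (ctr (3 + 1) Lc) Lc μ y g g₁ g₂ + symVh2KerAt (ctr (3 + 1) Lc) Lc μ y g g₂ g₁)) Lc (n + 1 + 1) μ y f
                          (b.2, (b.1 : Site (3 + 1))) f') (Lc ^ (n + 1 + 1)) b'.2 (translate (towerTorus Lc (fine Lc M) (n + 1)) (b'.1 : Site (3 + 1)) m₂) X Z a₀ e₀))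
                      (fN (x, κ₀)) ((z, Sum.inl β) : Idx (towerTorus Lc (fine Lc M) (n + 1)) (Fib 3)))
          = (1 / 2 : ℝ) * ((perF (towerTorus Lc (fine Lc M) (n + 1)) (W2SymOfK (AN (Roots.ctr Lc) (n + 1)) (Lc ^ (n + 1 + 1)) (fun κ u => dper (towerTorus Lc (fine Lc M) (n + 1)) (SpureRecOf 3 (Lc ^ (n + 1 + 1)) (tabsComp (n + 1 + 1) (one_le_of_neZero Lc) (Roots.ctr Lc).hr (Pn.cM (n + 1 + 1))).V
              (tabsComp (n + 1 + 1) (one_le_of_neZero Lc) (Roots.ctr Lc).hr (Pn.cM (n + 1 + 1))).H (fun _ => compChart (Roots.ctr Lc).rc Lc (n + 1 + 1) ((Roots.ctr Lc).s (n + 1 + 1)) (Lc ^ (n + 1 + 1)))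
              (Pn.cE (n + 1 + 1)) (Pn.cVH (n + 1 + 1)) (Pn.cΛ (n + 1 + 1)) 0 κ u)) (fun ρ w => dper (towerTorus Lc (fine Lc M) (n + 1)) ((tabsComp (n + 1 + 1) (one_le_of_neZero Lc) (Roots.ctr Lc).hr (Pn.cM (n + 1 + 1))).M 0 ρ w))
          (fun κ u κ' u' => dper (towerTorus Lc (fine Lc M) (n + 1)) (fun x z i₁ i₂ => ∑' e : Site (3 + 1),
              T2RecOf 3 (Lc ^ (n + 1 + 1)) (fun _ => compChart (Roots.ctr Lc).rc Lc (n + 1 + 1) ((Roots.ctr Lc).s (n + 1 + 1)) (Lc ^ (n + 1 + 1)))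
              (SpureRecOf 3 (Lc ^ (n + 1 + 1)) (tabsComp (n + 1 + 1) (one_le_of_neZero Lc) (Roots.ctr Lc).hr (Pn.cM (n + 1 + 1))).V
              (tabsComp (n + 1 + 1) (one_le_of_neZero Lc) (Roots.ctr Lc).hr (Pn.cM (n + 1 + 1))).H (fun _ => compChart (Roots.ctr Lc).rc Lc (n + 1 + 1) ((Roots.ctr Lc).s (n + 1 + 1)) (Lc ^ (n + 1 + 1)))
              (Pn.cE (n + 1 + 1)) (Pn.cVH (n + 1 + 1)) (Pn.cΛ (n + 1 + 1)))
              (tabsComp (n + 1 + 1) (one_le_of_neZero Lc) (Roots.ctr Lc).hr (Pn.cM (n + 1 + 1))).M (Pn.cE₂ (n + 1 + 1)) (Pn.cB (n + 1 + 1)) (Pn.T (n + 1 + 1))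
              (tabsComp (n + 1 + 1) (one_le_of_neZero Lc) (Roots.ctr Lc).hr (Pn.cM (n + 1 + 1))).vh₂S (tabsComp (n + 1 + 1) (one_le_of_neZero Lc) (Roots.ctr Lc).hr (Pn.cM (n + 1 + 1))).mixFF 0 κ u κ' (translate (towerTorus Lc (fine Lc M) (n + 1)) u' e) x z i₁ i₂))
          (fun κ u ρ w => dper (towerTorus Lc (fine Lc M) (n + 1)) (fun x z i₁ i₂ => ∑' e : Site (3 + 1),
              M2Of 3 (Lc ^ (n + 1 + 1)) (tabsComp (n + 1 + 1) (one_le_of_neZero Lc) (Roots.ctr Lc).hr (Pn.cM (n + 1 + 1))).mixFF 0 κ u ρ (translate M w e) x z i₁ i₂)) (μN a) (yN a) (μN a') (yN a'))) (fN (x, κ₀)) ((z, Sum.inl β) : Idx (towerTorus Lc (fine Lc M) (n + 1)) (Fib 3))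
              - (perF (towerTorus Lc (fine Lc M) (n + 1)) (W2SymOfK (AN (Roots.ctr Lc) (n + 1)) (Lc ^ (n + 1 + 1)) (fun κ u => dper (towerTorus Lc (fine Lc M) (n + 1)) (SpureRecOf 3 (Lc ^ (n + 1 + 1)) (tabsComp (n + 1 + 1) (one_le_of_neZero Lc) (Roots.ctr Lc).hr (Pn.cM (n + 1 + 1))).V
              (tabsComp (n + 1 + 1) (one_le_of_neZero Lc) (Roots.ctr Lc).hr (Pn.cM (n + 1 + 1))).H (fun _ => compChart (Roots.ctr Lc).rc Lc (n + 1 + 1) ((Roots.ctr Lc).s (n + 1 + 1)) (Lc ^ (n + 1 + 1)))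
              (Pn.cE (n + 1 + 1)) (Pn.cVH (n + 1 + 1)) (Pn.cΛ (n + 1 + 1)) 0 κ u)) (fun ρ w => dper (towerTorus Lc (fine Lc M) (n + 1)) ((tabsComp (n + 1 + 1) (one_le_of_neZero Lc) (Roots.ctr Lc).hr (Pn.cM (n + 1 + 1))).M 0 ρ w))
          (fun κ u κ' u' => dper (towerTorus Lc (fine Lc M) (n + 1)) (fun x z i₁ i₂ => ∑' e : Site (3 + 1),
              T2RecOf 3 (Lc ^ (n + 1 + 1)) (fun _ => compChart (Roots.ctr Lc).rc Lc (n + 1 + 1) ((Roots.ctr Lc).s (n + 1 + 1)) (Lc ^ (n + 1 + 1)))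
              (SpureRecOf 3 (Lc ^ (n + 1 + 1)) (tabsComp (n + 1 + 1) (one_le_of_neZero Lc) (Roots.ctr Lc).hr (Pn.cM (n + 1 + 1))).V
              (tabsComp (n + 1 + 1) (one_le_of_neZero Lc) (Roots.ctr Lc).hr (Pn.cM (n + 1 + 1))).H (fun _ => compChart (Roots.ctr Lc).rc Lc (n + 1 + 1) ((Roots.ctr Lc).s (n + 1 + 1)) (Lc ^ (n + 1 + 1)))
              (Pn.cE (n + 1 + 1)) (Pn.cVH (n + 1 + 1)) (Pn.cΛ (n + 1 + 1)))
              (tabsComp (n + 1 + 1) (one_le_of_neZero Lc) (Roots.ctr Lc).hr (Pn.cM (n + 1 + 1))).M (Pn.cE₂ (n + 1 + 1)) (Pn.cB (n + 1 + 1)) (Pn.T (n + 1 + 1))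
              (tabsComp (n + 1 + 1) (one_le_of_neZero Lc) (Roots.ctr Lc).hr (Pn.cM (n + 1 + 1))).vh₂S (tabsComp (n + 1 + 1) (one_le_of_neZero Lc) (Roots.ctr Lc).hr (Pn.cM (n + 1 + 1))).mixFF 0 κ u κ' (translate (towerTorus Lc (fine Lc M) (n + 1)) u' e) x z i₁ i₂))
          (fun κ u ρ w => dper (towerTorus Lc (fine Lc M) (n + 1)) (fun x z i₁ i₂ => ∑' e : Site (3 + 1),
              M2Of 3 (Lc ^ (n + 1 + 1)) (tabsComp (n + 1 + 1) (one_le_of_neZero Lc) (Roots.ctr Lc).hr (Pn.cM (n + 1 + 1))).mixFF 0 κ u ρ (translate M w e) x z i₁ i₂)) (μN a) (yN a) (μN a') (yN a'))) ((z, Sum.inl β) : Idx (towerTorus Lc (fine Lc M) (n + 1)) (Fib 3)) (fN (x, κ₀))) := by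
  rw [hQN2_row_iff_junction M n c Pn hNN hWN hδN fN hfN hc yN μN hv hhvl lv hlv hJW 𝔔₀ h𝔔₀' 𝔔₁f h𝔔₁' 𝔔₂f h𝔔₂' Xbf hXbf 𝔔'₂f h𝔔'₂f r a a',
    perF_dper_tsum_WN (Roots.ctr Lc) Pn (n + 1) (towerTorus Lc (fine Lc M) (n + 1)) (towerTorus_fine_apply M n) (μN a) (yN a) (μN a') (yN a')]

end Junction

end Summit.QuantumFields.BalabanUV.Beta.FP.TowerQN2RowWound

end
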